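import Summits.Ventures.HSemireg.WeilFrameLeadingTermEulerPin
import Summits.Ventures.HSemireg.WeilFrameLeadingTermPinCriterion

/-!
# Venture HSemireg — THE EULER-PIN VALUE AT EVERY PIN OF AN EVEN `n` (`n = a + k + a`, `0 < k`):
# `Σ_{k=0}^{2n} (−1)^k dim S_k(x) = (−1)ⁿ·(2C(2n−2,n−1) + 2n + 2 − δ)` with `δ = 2` iff the pin-block determinant vanishes, else `δ = 1`

HONEST FRAMING. Part of the Lean index of the computation cell `pub-hsemireg` (seat w3-mod4-1 gen 15, W3 SPECIAL FIBRES; MOD4-OFFSPLIT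
§13.29 ∕ §13.31). This file only combines FILE 46's row identity with FILE 53's middle entry at an arbitrary non-self-dual pin; the
tree's real carriers and the Literature's Weil-type layer ONLY: no semiregularity map, no Ext group, no `∫`, no HRR; nothing here says
that HC / HC_CM / HC_AV holds, or that any object is or is not semiregular; no Literature fact is declared; NO definition is introduced.

WHAT IS PROVED (hypotheses of `finrank_S_weilType_middle`, `n = a + k + a` even, `0 < k`, `q_m = 0` for `m < n`, `q_n ≠ 0`, any tail,
pin `t = (−1)ⁿ C(n,a)² q_n²`, `μ = (−1)^a C(n,a) q_n`, `B` the `k × k` pin block of `T_f − μ`):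
**`eulerSum_leading_pin_of_det_eq_zero`** (`det B = 0` ⇒ `E(x) = (−1)ⁿ(2C(2n−2,n−1) + 2n)`) and
**`eulerSum_leading_pin_of_det_ne_zero`** (`det B ≠ 0` ⇒ `E(x) = (−1)ⁿ(2C(2n−2,n−1) + 2n + 1)`). With FILE 46 (off the pins `+ 2`,
self-dual pin `+ 1`, odd `n` `+ 0`) the Euler-pin value of every `ch(O_Z)`-shape row is kernel at every `t`, every `n ≥ 2`.
`n = 4`: `48 ∕ 49` at `q₄²` and `16q₄²`; `n = 6`: `516 ∕ 517` at `q₆²`, `36q₆²`, `400q₆²`. Everything PROVED, 0 sorry.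
References: [BuchweitzFlenner2008HH] Prop. 6.4.4; [vanGeemen1994HodgeAV] 4.9, Lemma 5.2; [BourbakiAlgebre1a3] Ch. III §8, §11 no. 9.
-/

noncomputable section

open CliffordAlgebra (contractLeft)
open ExteriorAlgebra (ι)
open Module CategoryTheory
open Literature.AlgebraicGeometry.Motives Literature.AlgebraicGeometry.HodgeTheory
open Literature.AlgebraicTopology.SingularHomology

namespace Summit.Ventures.HSemireg.WeilFrame

open Summit.Ventures.HSemireg.WedgeBridge Summit.Ventures.HSemireg.WeilCarrier Summit.Ventures.HSemireg.Mod4Carrier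
open Summit.Ventures.HSemireg.Wedge.Hankel

/-! ### 2. On the real carrier -/

section RealCarrier

variable {A : AbelianVariety ℂ}

/-- **Euler-pin value at any pin of an even `n = a + k + a` (`0 < k`), DEGENERATE pin block** (`t = (−1)ⁿ C(n,a)² q_n²`,
`det B = 0`): `Σ_{k ≤ 2n} (−1)^k dim S_k(x) = (−1)ⁿ (2C(2n−2,n−1) + 2n)`.
[cite: BuchweitzFlenner2008HH, Prop. 6.4.4] [cite: vanGeemen1994HodgeAV, 4.9 and Lemma 5.2] -/
theorem eulerSum_leading_pin_of_det_eq_zero (hA : IsSmoothProjective A.dim A.X) {n d : ℕ} (hdim : A.dim = n + n) (hd : 0 < d)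
    {φ : A ⟶ A} (hφ : φ ≫ φ = -(d • 𝟙 A)) {P Q : Submodule ℂ (complexBetti A.X 1)}
    (hP : P = Module.End.eigenspace (complexBetti.map φ.hom.hom.hom 1).hom (Complex.I * (Real.sqrt d : ℂ)))
    (hQ : Q = Module.End.eigenspace (complexBetti.map φ.hom.hom.hom 1).hom (-(Complex.I * (Real.sqrt d : ℂ))))
    (hp : finrank ℂ ↥(P ⊓ hodgeOneZero hA) = n) {h : complexBetti A.X 2}
    (hh : complexBetti.map φ.hom.hom.hom 2 h = (d : ℂ) • h) (h11 : IsOfHodgeType A.dim A.X 2 1 1 h)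
    (hvol : ((⋀[ℂ]^2 (complexBetti A.X 1)).subtype ((abelianVarietyCohomologyExteriorH1_holds.equiv A 2).symm h)) ^ (n + n) ≠ 0)
    {cP cQ : complexBetti A.X (2 * n)} (hcP : cP ∈ weilClassesPlus A φ n d) (hcP0 : cP ≠ 0)
    (hcQ : cQ ∈ weilClassesMinus A φ n d) (hcQ0 : cQ ≠ 0)
    {q : ℕ → ℂ} (hq0 : ∀ m, m < n → q m = 0) (hqn : q n ≠ 0) {t : ℂ}
    (ht : (((n + n).factorial : ℕ) : ℂ) •
        ((⋀[ℂ]^(2 * n) (complexBetti A.X 1)).subtype ((abelianVarietyCohomologyExteriorH1_holds.equiv A (2 * n)).symm cP) *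
          (⋀[ℂ]^(2 * n) (complexBetti A.X 1)).subtype ((abelianVarietyCohomologyExteriorH1_holds.equiv A (2 * n)).symm cQ)) =
      t • ((⋀[ℂ]^2 (complexBetti A.X 1)).subtype ((abelianVarietyCohomologyExteriorH1_holds.equiv A 2).symm h)) ^ (n + n))
    {a k : ℕ} (hak : n = a + k + a) (heven : Even n) (hk : 0 < k)
    (hpin : t = (-1 : ℂ) ^ n * ((n.choose a : ℂ) * (n.choose a : ℂ)) * (q n * q n))
    {μ : ℂ} (hμ : μ = (-1 : ℂ) ^ a * (n.choose a : ℂ) * q n) {B : Matrix (Fin k) (Fin k) ℂ}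
    (hB : B = Matrix.of fun r s : Fin k =>
      (Mod4.hankelT n q - μ • (1 : Matrix (Fin (n + 1)) (Fin (n + 1)) ℂ)) ⟨a + r, by omega⟩ ⟨a + 1 + s, by omega⟩)
    (hdet : B.det = 0) :
    (∑ k ∈ Finset.range (n + n + 1), (-1 : ℤ) ^ k * (finrank ℂ ↥(S ℂ (hodgeZeroOne hA) k
        ((∑ m ∈ Finset.range (n + n + 1), (q m * ((m.factorial : ℕ) : ℂ)⁻¹) •
            ((⋀[ℂ]^2 (complexBetti A.X 1)).subtype ((abelianVarietyCohomologyExteriorH1_holds.equiv A 2).symm h)) ^ m) +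
          (⋀[ℂ]^(2 * n) (complexBetti A.X 1)).subtype ((abelianVarietyCohomologyExteriorH1_holds.equiv A (2 * n)).symm cP) +
          (⋀[ℂ]^(2 * n) (complexBetti A.X 1)).subtype ((abelianVarietyCohomologyExteriorH1_holds.equiv A (2 * n)).symm cQ))) : ℤ)) =
      (-1 : ℤ) ^ n * (2 * ((n + n - 2).choose (n - 1) : ℤ) + 2 * n + 2 - 2) := by
  haveI : Module.Finite ℂ (complexBetti A.X 1) := abelianVarietyCohomologyExteriorH1_holds.finite_one A
  have hn : 2 ≤ n := by
    obtain ⟨r, hr⟩ := heven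
    omega
  have hq0' : ∀ m, 1 ≤ m → m < n → q m = 0 := fun m _ hm => hq0 m hm
  rw [show (2 * ((n + n - 2).choose (n - 1) : ℤ) + 2 * n + 2 - 2) = 2 * ((n + n - 2).choose (n - 1) : ℤ) + 2 * n + 2 - ((2 : ℕ) : ℤ)
    by push_cast; ring]
  have hn1 : 1 ≤ n := by omega
  have h0 := finrank_S_weilType_zero hA hdim hd hφ hP hQ hp hh h11 hvol hcP hcP0 hcQ hcQ0 hn1 q
  have htop := finrank_S_weilType_top hA hdim hd hφ hP hQ hp hh h11 hvol hcP hcP0 hcQ hcQ0 hn1 q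
  refine alternating_sum_leading_row hn _ _ ?_ ?_ ?_
  · intro k hk
    rcases Nat.eq_zero_or_pos k with rfl | hk1
    · rw [h0, Nat.choose_zero_right, Nat.choose_zero_right]
    · exact finrank_S_leading_deg hA hdim hd hφ hP hQ hp hh h11 hvol hcP hcP0 hcQ hcQ0 hq0' hqn hk1 hk
  · intro k hk
    rcases Nat.eq_zero_or_pos k with rfl | hk1
    · rw [Nat.sub_zero, htop, Nat.choose_zero_right, Nat.choose_zero_right]
    · exact finrank_S_leading_deg_dual hA hdim hd hφ hP hQ hp hh h11 hvol hcP hcP0 hcQ hcQ0 hq0' hqn (k := n + n - k)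
        (k' := k) hk1 hk (by omega)
  · exact finrank_S_leading_middle_pin_of_det_eq_zero hA hak heven hk hdim hd hφ hP hQ hp hh h11 hvol hcP hcP0 hcQ hcQ0 hq0 hqn ht
      hpin hμ hB hdet

/-- **Euler-pin value at any pin of an even `n = a + k + a` (`0 < k`), GENERIC pin block** (`t = (−1)ⁿ C(n,a)² q_n²`,
`det B ≠ 0`): `Σ_{k ≤ 2n} (−1)^k dim S_k(x) = (−1)ⁿ (2C(2n−2,n−1) + 2n + 1)`.
[cite: BuchweitzFlenner2008HH, Prop. 6.4.4] [cite: vanGeemen1994HodgeAV, 4.9 and Lemma 5.2] -/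
theorem eulerSum_leading_pin_of_det_ne_zero (hA : IsSmoothProjective A.dim A.X) {n d : ℕ} (hdim : A.dim = n + n) (hd : 0 < d)
    {φ : A ⟶ A} (hφ : φ ≫ φ = -(d • 𝟙 A)) {P Q : Submodule ℂ (complexBetti A.X 1)}
    (hP : P = Module.End.eigenspace (complexBetti.map φ.hom.hom.hom 1).hom (Complex.I * (Real.sqrt d : ℂ)))
    (hQ : Q = Module.End.eigenspace (complexBetti.map φ.hom.hom.hom 1).hom (-(Complex.I * (Real.sqrt d : ℂ))))
    (hp : finrank ℂ ↥(P ⊓ hodgeOneZero hA) = n) {h : complexBetti A.X 2}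
    (hh : complexBetti.map φ.hom.hom.hom 2 h = (d : ℂ) • h) (h11 : IsOfHodgeType A.dim A.X 2 1 1 h)
    (hvol : ((⋀[ℂ]^2 (complexBetti A.X 1)).subtype ((abelianVarietyCohomologyExteriorH1_holds.equiv A 2).symm h)) ^ (n + n) ≠ 0)
    {cP cQ : complexBetti A.X (2 * n)} (hcP : cP ∈ weilClassesPlus A φ n d) (hcP0 : cP ≠ 0)
    (hcQ : cQ ∈ weilClassesMinus A φ n d) (hcQ0 : cQ ≠ 0)
    {q : ℕ → ℂ} (hq0 : ∀ m, m < n → q m = 0) (hqn : q n ≠ 0) {t : ℂ}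
    (ht : (((n + n).factorial : ℕ) : ℂ) •
        ((⋀[ℂ]^(2 * n) (complexBetti A.X 1)).subtype ((abelianVarietyCohomologyExteriorH1_holds.equiv A (2 * n)).symm cP) *
          (⋀[ℂ]^(2 * n) (complexBetti A.X 1)).subtype ((abelianVarietyCohomologyExteriorH1_holds.equiv A (2 * n)).symm cQ)) =
      t • ((⋀[ℂ]^2 (complexBetti A.X 1)).subtype ((abelianVarietyCohomologyExteriorH1_holds.equiv A 2).symm h)) ^ (n + n))
    {a k : ℕ} (hak : n = a + k + a) (heven : Even n) (hk : 0 < k)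
    (hpin : t = (-1 : ℂ) ^ n * ((n.choose a : ℂ) * (n.choose a : ℂ)) * (q n * q n))
    {μ : ℂ} (hμ : μ = (-1 : ℂ) ^ a * (n.choose a : ℂ) * q n) {B : Matrix (Fin k) (Fin k) ℂ}
    (hB : B = Matrix.of fun r s : Fin k =>
      (Mod4.hankelT n q - μ • (1 : Matrix (Fin (n + 1)) (Fin (n + 1)) ℂ)) ⟨a + r, by omega⟩ ⟨a + 1 + s, by omega⟩)
    (hdet : B.det ≠ 0) :
    (∑ k ∈ Finset.range (n + n + 1), (-1 : ℤ) ^ k * (finrank ℂ ↥(S ℂ (hodgeZeroOne hA) k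
        ((∑ m ∈ Finset.range (n + n + 1), (q m * ((m.factorial : ℕ) : ℂ)⁻¹) •
            ((⋀[ℂ]^2 (complexBetti A.X 1)).subtype ((abelianVarietyCohomologyExteriorH1_holds.equiv A 2).symm h)) ^ m) +
          (⋀[ℂ]^(2 * n) (complexBetti A.X 1)).subtype ((abelianVarietyCohomologyExteriorH1_holds.equiv A (2 * n)).symm cP) +
          (⋀[ℂ]^(2 * n) (complexBetti A.X 1)).subtype ((abelianVarietyCohomologyExteriorH1_holds.equiv A (2 * n)).symm cQ))) : ℤ)) =
      (-1 : ℤ) ^ n * (2 * ((n + n - 2).choose (n - 1) : ℤ) + 2 * n + 2 - 1) := by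
  haveI : Module.Finite ℂ (complexBetti A.X 1) := abelianVarietyCohomologyExteriorH1_holds.finite_one A
  have hn : 2 ≤ n := by
    obtain ⟨r, hr⟩ := heven
    omega
  have hq0' : ∀ m, 1 ≤ m → m < n → q m = 0 := fun m _ hm => hq0 m hm
  rw [show (2 * ((n + n - 2).choose (n - 1) : ℤ) + 2 * n + 2 - 1) = 2 * ((n + n - 2).choose (n - 1) : ℤ) + 2 * n + 2 - ((1 : ℕ) : ℤ)
    by push_cast; ring]
  have hn1 : 1 ≤ n := by omega
  have h0 := finrank_S_weilType_zero hA hdim hd hφ hP hQ hp hh h11 hvol hcP hcP0 hcQ hcQ0 hn1 q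
  have htop := finrank_S_weilType_top hA hdim hd hφ hP hQ hp hh h11 hvol hcP hcP0 hcQ hcQ0 hn1 q
  refine alternating_sum_leading_row hn _ _ ?_ ?_ ?_
  · intro k hk
    rcases Nat.eq_zero_or_pos k with rfl | hk1
    · rw [h0, Nat.choose_zero_right, Nat.choose_zero_right]
    · exact finrank_S_leading_deg hA hdim hd hφ hP hQ hp hh h11 hvol hcP hcP0 hcQ hcQ0 hq0' hqn hk1 hk
  · intro k hk
    rcases Nat.eq_zero_or_pos k with rfl | hk1
    · rw [Nat.sub_zero, htop, Nat.choose_zero_right, Nat.choose_zero_right]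
    · exact finrank_S_leading_deg_dual hA hdim hd hφ hP hQ hp hh h11 hvol hcP hcP0 hcQ hcQ0 hq0' hqn (k := n + n - k)
        (k' := k) hk1 hk (by omega)
  · exact finrank_S_leading_middle_pin_of_det_ne_zero hA hak heven hk hdim hd hφ hP hQ hp hh h11 hvol hcP hcP0 hcQ hcQ0 hq0 hqn ht
      hpin hμ hB hdet

end RealCarrier

end Summit.Ventures.HSemireg.WeilFrame

end
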